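import Literature.Computability.Cryptography.VanDamSeroussiOracleBQP

/-!
# QuantumAdvantage / ArithStatLadder — `AvgFaceBeyondPrior`, line `mirror-unit-signature`:
# the certificate checks of the certified unit language (part CU-1 of stub `stub_oracleLangMemBQP`,
# stmt-QuantumAdvantage-2427)

The certified unit language `CU = {⟨bin d, code(primeFactorsList d)⟩ : −d fundamental, d ≠ 3, UnitCubeAtThree d}`
carries the prime factorisation of `d` as a certificate. This file proves that the CLASSICAL GUARD of its
quantum decision procedure is polynomial time (`exists_goodFn`): a Boolean `good ∈ FP` (in the tree's typed
algebra `CodeFP`, Arora–Barak 2009, §1.3) with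

  `good w = true ⟺ ∃ d, w = ⟨bin d, code(primeFactorsList d)⟩ ∧ −d fundamental ∧ d ≠ 3`.

The guard re-pairs the query, checks that its first field is a canonical numeral `bin d` and its second
field a canonical list code `code(ps)`, that `ps` is non-decreasing, all prime (the tree's `primeFn`,
Agrawal–Kayal–Saxena) with product `d` — so that `ps = primeFactorsList d`
(`QuadCongNP.eq_primeFactorsList_iff`) — and decides the fundamental-discriminant predicate of `−d` from
`ps` (square-freeness of a divisor `m` of `d` is "no `p ∈ ps` with `p² ∣ m`").

Pattern: `Literature/Computability/Cryptography/VanDamSeroussiOracleFP.lean` (`codeFP_certOK`). Everything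
used is proved in the tree; no definition, no named fact.
-/

set_option linter.dupNamespace false -- D-0017: single-problem summit ⇒ `QuantumAdvantage.QuantumAdvantage` by design

namespace Summit.QuantumAdvantage.QuantumAdvantage.Theorems.AvgFaceBeyondPrior.Mirror

open _root_.Computability
open Literature.Computability.Complexity Literature.Computability.Cryptography
open Literature.Computability.Complexity.Brick Literature.Computability.Complexity.CodeFP

/-! ### Polynomial-time pieces -/

/-- `fstF` on strings (private one-liner, as in `VanDamSeroussiOracleFP.lean`). [folklore] -/
private theorem codeFP_fstF : CodeFP strE strE fstF := ⟨fstF, fstF_mem_FP, fun _ => rfl⟩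

/-- `sndF` on strings (private one-liner, as in `VanDamSeroussiOracleFP.lean`). [folklore] -/
private theorem codeFP_sndF : CodeFP strE strE sndF := ⟨sndF, sndF_mem_FP, fun _ => rfl⟩

/-- Products of lists of binary numerals are polynomial time (private copy of the one-liner of
`VanDamSeroussiOracleFP.lean`: the code of a product is at most one bit longer than the raw code of the
list). [folklore] -/
private theorem codeFP_listProd : CodeFP (rawE natE) natE List.prod := by
  have h := foldl₀ (eα := natE) (eβ := natE) (step := fun (a : ℕ) (b : ℕ) => b * a) (b₀ := 1)
    (natMul.comp ((snd _ _).pair (fst _ _))) (Polynomial.X + 1) (fun l₁ l₂ => by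
      rw [Polynomial.eval_add, Polynomial.eval_X, Polynomial.eval_one, ← List.prod_eq_foldl]
      refine (length_natE_le_of_lt (prod_lt_two_pow_length_rawE_succ l₁)).trans ?_
      have := length_rawE_le_of_sublist natE (List.sublist_append_left l₁ l₂)
      omega)
  exact h.congr fun l => by rw [← List.prod_eq_foldl]

/-- **The order test is polynomial time**: `l ↦ ∧ᵢ [lᵢ ≤ lᵢ₊₁]` (a `zipWith` of `l` with its tail,
then `all`). [folklore] -/
theorem codeFP_sortedBit :
    CodeFP (rawE natE) bitE (fun l : List ℕ => (List.zipWith (fun a b => decide (a ≤ b)) l l.tail).all fun t => t) := by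
  have hzw := zipWith (σ := Unit) (eσ := unitE) (eα := natE) (eβ := natE) (eγ := bitE)
    (g := fun t => decide (t.2.1 ≤ t.2.2)) (natLe.comp (snd _ _))
  have hall := all (σ := Unit) (eσ := unitE) (eα := bitE) (p := fun t => t.2) (snd _ _)
  exact (hall.comp ((const _ ()).pair (hzw.comp ((const _ ()).pair ((CodeFP.id _).pair (rawTail natE)))))).congr
    fun _ => rfl

/-- **Semantics of the order test**: it holds iff the list is a `≤`-chain. [folklore] -/
theorem sortedBit_eq_true_iff : ∀ l : List ℕ,
    (List.zipWith (fun a b => decide (a ≤ b)) l l.tail).all (fun t => t) = true ↔ List.IsChain (· ≤ ·) l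
  | [] => by simp
  | [a] => by simp
  | a :: b :: l => by
    rw [List.tail_cons, List.zipWith_cons_cons, List.all_cons, Bool.and_eq_true, decide_eq_true_eq,
      List.isChain_cons_cons, ← sortedBit_eq_true_iff (b :: l), List.tail_cons]

/-- **The square-freeness test of `m` against a list of primes**: no `p` in the list with `p² ∣ m`
(context `m`, items `p`). [folklore] -/
theorem codeFP_sqfBit :
    CodeFP (pairE natE (rawE natE)) bitE (fun q : ℕ × List ℕ => q.2.all fun p => !decide (q.1 % (p * p) = 0)) := by
  have hitem : CodeFP (pairE natE natE) bitE (fun q : ℕ × ℕ => !decide (q.1 % (q.2 * q.2) = 0)) :=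
    (natEq.comp ((natMod.comp ((fst _ _).pair (natMul.comp ((snd _ _).pair (snd _ _))))).pair (const _ 0))).not
  exact (all hitem).congr fun _ => rfl

/-- **Semantics of the square-freeness test**: for `0 < m ∣ d`, "no prime factor `p` of `d` has
`p² ∣ m`" is `Squarefree m`. [folklore] -/
theorem sqfBit_eq_true_iff {d m : ℕ} (hd : d ≠ 0) (hmd : m ∣ d) :
    (d.primeFactorsList.all fun p => !decide (m % (p * p) = 0)) = true ↔ Squarefree m := by
  rw [List.all_eq_true, Nat.squarefree_iff_prime_squarefree]
  simp only [Bool.not_eq_true', decide_eq_false_iff_not, ← Nat.dvd_iff_mod_eq_zero]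
  constructor
  · intro h p hp hpm
    exact h p (Nat.mem_primeFactorsList'.2 ⟨hp, (dvd_trans (Dvd.intro _ rfl) hpm).trans hmd, hd⟩) hpm
  · intro h p hp
    exact h p (Nat.prime_of_mem_primeFactorsList hp)

/-- **The fundamentality test** of `−d` from `d` and a list `ps` (meant to be `primeFactorsList d`):
`(d ≡ 3 (4) ∧ d square-free) ∨ (4 ∣ d ∧ d/4 ≡ 1, 2 (4) ∧ d/4 square-free)`. [folklore] -/
theorem codeFP_fundBit :
    CodeFP (pairE natE (rawE natE)) bitE (fun q : ℕ × List ℕ =>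
      (decide (q.1 % 4 = 3) && q.2.all fun p => !decide (q.1 % (p * p) = 0)) ||
        (decide (q.1 % 4 = 0) && (decide (q.1 / 4 % 4 = 1) || decide (q.1 / 4 % 4 = 2)) &&
          q.2.all fun p => !decide (q.1 / 4 % (p * p) = 0))) := by
  have hd : CodeFP (pairE natE (rawE natE)) natE (fun q : ℕ × List ℕ => q.1) := fst _ _
  have hps : CodeFP (pairE natE (rawE natE)) (rawE natE) (fun q : ℕ × List ℕ => q.2) := snd _ _
  have hd4 : CodeFP (pairE natE (rawE natE)) natE (fun q : ℕ × List ℕ => q.1 / 4) := natDiv.comp (hd.pair (const _ 4))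
  have hmod : ∀ {X : ℕ × List ℕ → ℕ}, CodeFP (pairE natE (rawE natE)) natE X → ∀ k r : ℕ,
      CodeFP (pairE natE (rawE natE)) bitE (fun q => decide (X q % k = r)) := fun hX k r =>
    natEq.comp ((natMod.comp (hX.pair (const _ k))).pair (const _ r))
  have h1 := ((hmod hd 4 3).and (codeFP_sqfBit.comp (hd.pair hps))).or
    (((hmod hd 4 0).and ((hmod hd4 4 1).or (hmod hd4 4 2))).and (codeFP_sqfBit.comp (hd4.pair hps)))
  exact h1.congr fun _ => rfl

/-- **Semantics of the fundamentality test**: on `ps = primeFactorsList d`, `0 < d`, it decides the route's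
literal predicate "`−d` is a fundamental discriminant". [folklore] -/
theorem fundBit_eq_true_iff {d : ℕ} (hd : 0 < d) :
    ((decide (d % 4 = 3) && d.primeFactorsList.all fun p => !decide (d % (p * p) = 0)) ||
        (decide (d % 4 = 0) && (decide (d / 4 % 4 = 1) || decide (d / 4 % 4 = 2)) &&
          d.primeFactorsList.all fun p => !decide (d / 4 % (p * p) = 0))) = true ↔
      (((-(d:ℤ)) % 4 = 1 ∧ Squarefree (-(d:ℤ)) ∧ (-(d:ℤ)) ≠ 1) ∨
        (4 ∣ (-(d:ℤ)) ∧ ((-(d:ℤ)) / 4 % 4 = 2 ∨ (-(d:ℤ)) / 4 % 4 = 3) ∧ Squarefree ((-(d:ℤ)) / 4))) := by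
  have hsqZ : ∀ n : ℕ, Squarefree (-(n:ℤ)) ↔ Squarefree n := fun n => by
    rw [← Int.squarefree_natAbs, Int.natAbs_neg, Int.natAbs_natCast]
  have hd0 : d ≠ 0 := hd.ne'
  rw [Bool.or_eq_true, Bool.and_eq_true, Bool.and_eq_true, Bool.and_eq_true, Bool.or_eq_true, decide_eq_true_eq,
    decide_eq_true_eq, decide_eq_true_eq, decide_eq_true_eq, sqfBit_eq_true_iff hd0 dvd_rfl, hsqZ]
  by_cases h4 : d % 4 = 0
  · have hdv : 4 ∣ d := Nat.dvd_of_mod_eq_zero h4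
    have hneg : (-(d:ℤ)) / 4 = -((d / 4 : ℕ) : ℤ) := by omega
    rw [sqfBit_eq_true_iff hd0 (Nat.div_dvd_of_dvd hdv), hneg, hsqZ]
    constructor
    · rintro (⟨h3, -⟩ | ⟨⟨-, h12⟩, hsq⟩)
      · omega
      · exact Or.inr ⟨by omega, by omega, hsq⟩
    · rintro (⟨h1, -, -⟩ | ⟨-, h23, hsq⟩)
      · omega
      · exact Or.inr ⟨⟨h4, by omega⟩, hsq⟩
  · constructor
    · rintro (⟨h3, hsq⟩ | ⟨⟨h0, -⟩, -⟩)
      · exact Or.inl ⟨by omega, hsq, by omega⟩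
      · exact absurd h0 h4
    · rintro (⟨h1, hsq, -⟩ | ⟨h4', -, -⟩)
      · exact Or.inl ⟨by omega, hsq⟩
      · exfalso; omega

/-- **The certificate check** `chk (d, ps)`: `ps` non-decreasing, all prime, `∏ ps = d`, the
fundamentality test, and `d ≠ 3` — polynomial time. [folklore] -/
theorem codeFP_chk :
    CodeFP (pairE natE (rawE natE)) bitE (fun q : ℕ × List ℕ =>
      (List.zipWith (fun a b => decide (a ≤ b)) q.2 q.2.tail).all (fun t => t) && q.2.all (fun p => decide p.Prime) &&
        decide (q.2.prod = q.1) &&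
      ((decide (q.1 % 4 = 3) && q.2.all fun p => !decide (q.1 % (p * p) = 0)) ||
        (decide (q.1 % 4 = 0) && (decide (q.1 / 4 % 4 = 1) || decide (q.1 / 4 % 4 = 2)) &&
          q.2.all fun p => !decide (q.1 / 4 % (p * p) = 0))) &&
      !decide (q.1 = 3)) := by
  have hd : CodeFP (pairE natE (rawE natE)) natE (fun q : ℕ × List ℕ => q.1) := fst _ _
  have hps : CodeFP (pairE natE (rawE natE)) (rawE natE) (fun q : ℕ × List ℕ => q.2) := snd _ _
  have hprime := (all (σ := ℕ) (eσ := natE) (eα := natE) (p := fun t => decide t.2.Prime)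
    (VDSOracle.codeFP_prime.comp (snd _ _)))
  have hprod := natEq.comp ((codeFP_listProd.comp hps).pair hd)
  have h3 := (natEq.comp (hd.pair (const _ 3))).not
  exact (((((codeFP_sortedBit.comp hps).and hprime).and hprod).and codeFP_fundBit).and h3).congr fun _ => rfl

/-- **Semantics of the certificate check**: `chk (d, ps)` holds iff `ps = primeFactorsList d`, `−d` is a
fundamental discriminant, and `d ≠ 3`. [folklore] -/
theorem chk_eq_true_iff (d : ℕ) (ps : List ℕ) :
    ((List.zipWith (fun a b => decide (a ≤ b)) ps ps.tail).all (fun t => t) && ps.all (fun p => decide p.Prime) &&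
        decide (ps.prod = d) &&
      ((decide (d % 4 = 3) && ps.all fun p => !decide (d % (p * p) = 0)) ||
        (decide (d % 4 = 0) && (decide (d / 4 % 4 = 1) || decide (d / 4 % 4 = 2)) &&
          ps.all fun p => !decide (d / 4 % (p * p) = 0))) &&
      !decide (d = 3)) = true ↔
    ps = d.primeFactorsList ∧
      ((((-(d:ℤ)) % 4 = 1 ∧ Squarefree (-(d:ℤ)) ∧ (-(d:ℤ)) ≠ 1) ∨
        (4 ∣ (-(d:ℤ)) ∧ ((-(d:ℤ)) / 4 % 4 = 2 ∨ (-(d:ℤ)) / 4 % 4 = 3) ∧ Squarefree ((-(d:ℤ)) / 4)))) ∧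
      d ≠ 3 := by
  rw [Bool.and_eq_true, Bool.and_eq_true, Bool.and_eq_true, Bool.and_eq_true, sortedBit_eq_true_iff,
    List.isChain_iff_pairwise, List.all_eq_true, decide_eq_true_eq, Bool.not_eq_true', decide_eq_false_iff_not]
  simp only [decide_eq_true_eq]
  rcases Nat.eq_zero_or_pos d with rfl | hd
  · -- `d = 0`: a list of primes has a nonzero product, and `−0` is not fundamental
    constructor
    · rintro ⟨⟨⟨⟨-, hpr⟩, hprod⟩, -⟩, -⟩
      exact absurd (hpr 0 (List.prod_eq_zero_iff.1 hprod)) Nat.not_prime_zero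
    · rintro ⟨-, hf, -⟩
      norm_num at hf
  · constructor
    · rintro ⟨⟨⟨⟨hs, hpr⟩, hprod⟩, hf⟩, h3⟩
      obtain rfl := (QuadCongNP.eq_primeFactorsList_iff ps d hd).1 ⟨hs, hpr, hprod⟩
      exact ⟨rfl, (fundBit_eq_true_iff hd).1 hf, h3⟩
    · rintro ⟨rfl, hf, h3⟩
      obtain ⟨hs, hpr, hprod⟩ := (QuadCongNP.eq_primeFactorsList_iff _ d hd).2 rfl
      exact ⟨⟨⟨⟨hs, hpr⟩, hprod⟩, (fundBit_eq_true_iff hd).2 hf⟩, h3⟩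

/-! ### The guard of the certified unit language -/

/-- **The classical guard of the certified unit language is polynomial time, with its semantics**:
some `good` computed on codes in polynomial time has `good w = true` iff
`w = ⟨bin d, code(primeFactorsList d)⟩` for a `d ≠ 3` with `−d` a fundamental discriminant.
(The guard re-pairs `w`, tests canonicity of both fields — `encodeNat (bitsToNat x) = x`,
`certCode (parseF c) = c` — and runs the certificate check on `(bitsToNat x, parseF c)`.) [folklore] -/
theorem exists_goodFn : ∃ good : List Bool → Bool, CodeFP strE bitE good ∧ ∀ w : List Bool, good w = true ↔
    ∃ d : ℕ, w = boolPair (encodeNat d) (encodingListNatBool.encode (Nat.primeFactorsList d)) ∧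
      ((((-(d:ℤ)) % 4 = 1 ∧ Squarefree (-(d:ℤ)) ∧ (-(d:ℤ)) ≠ 1) ∨
        (4 ∣ (-(d:ℤ)) ∧ ((-(d:ℤ)) / 4 % 4 = 2 ∨ (-(d:ℤ)) / 4 % 4 = 3) ∧ Squarefree ((-(d:ℤ)) / 4)))) ∧
      d ≠ 3 := by
  -- the pieces of the guard
  have hpair : CodeFP strE strE (fun w => boolPair (fstF w) (sndF w)) :=
    (codeFP_fstF.pair codeFP_sndF).recodeOut fun _ => rfl
  have hcanon : CodeFP strE strE (fun w => encodeNat (bitsToNat (fstF w))) :=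
    (strOfNat.comp (strVal.comp codeFP_fstF)).congr fun _ => rfl
  have hps : CodeFP strE (rawE natE) (fun w => VDSOracle.parseF (sndF w)) := VDSOracle.codeFP_parseF.comp codeFP_sndF
  have hcode : CodeFP strE strE (fun w => VDSOracle.certCode (VDSOracle.parseF (sndF w))) :=
    (((transparent (eα := listE natE) (eβ := strE) (g := VDSOracle.certCode) fun _ => rfl).comp (listOfRaw natE)).comp
      hps).congr fun _ => rfl
  have hd : CodeFP strE natE (fun w => bitsToNat (fstF w)) := strVal.comp codeFP_fstF
  have heqS : CodeFP (pairE strE strE) bitE (fun p => decide (p.1 = p.2)) := CodeFP.eq (eα := strE) Function.injective_id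
  have hchk' := codeFP_chk.comp (hd.pair hps)
  have hgood := (((heqS.comp (hpair.pair (CodeFP.id strE))).and (heqS.comp (hcanon.pair codeFP_fstF))).and
    (heqS.comp (hcode.pair codeFP_sndF))).and hchk'
  refine ⟨_, hgood, fun w => ?_⟩
  dsimp only [id]
  rw [Bool.and_eq_true, Bool.and_eq_true, Bool.and_eq_true, decide_eq_true_eq, decide_eq_true_eq, decide_eq_true_eq,
    chk_eq_true_iff]
  constructor
  · rintro ⟨⟨⟨hw, hx⟩, hc⟩, hps', hf, h3⟩
    refine ⟨bitsToNat (fstF w), ?_, hf, h3⟩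
    rw [VDSOracle.encode_primeFactorsList_eq, ← hps', hc, hx, hw]
  · rintro ⟨d, rfl, hf, h3⟩
    have hpf : VDSOracle.parseF (VDSOracle.certCode d.primeFactorsList) = d.primeFactorsList := by
      simpa using VDSOracle.parseF_certCode_append d.primeFactorsList []
    rw [fstF_boolPair, sndF_boolPair, bitsToNat_encodeNat, VDSOracle.encode_primeFactorsList_eq, hpf]
    exact ⟨⟨⟨rfl, rfl⟩, rfl⟩, rfl, hf, h3⟩

end Summit.QuantumAdvantage.QuantumAdvantage.Theorems.AvgFaceBeyondPrior.Mirror
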